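import Summits.AtomisticToContinuum.BoseEinsteinCondensation.Theorems.BECGroundStateSOSPeriodicIRBoundDefs
import Summits.AtomisticToContinuum.BoseEinsteinCondensation.Theorems.BECGroundStateSOSPeriodicIRBoundWFDefs
import Summits.AtomisticToContinuum.BoseEinsteinCondensation.Theorems.BECGroundStateSOSPeriodicIRBoundWFVariational
import Summits.AtomisticToContinuum.BoseEinsteinCondensation.Theorems.BECGroundStateSOSPeriodicIRBoundWFRegularity
import Summits.AtomisticToContinuum.BoseEinsteinCondensation.Theorems.BECGroundStateSOSPeriodicIRBoundWFKinematics
import Summits.AtomisticToContinuum.BoseEinsteinCondensation.Theorems.BECGroundStateSOSPeriodicIRBoundWFPolar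
import Literature.MathematicalPhysics.QuantumManyBody.PeriodicBoseGasMomentumSector
import Literature.MathematicalPhysics.QuantumManyBody.TorusFockLayer
import Literature.MathematicalPhysics.QuantumManyBody.TorusFockSectorInteraction
import Literature.MathematicalPhysics.QuantumManyBody.PeriodicFormDomain
import Literature.MathematicalPhysics.QuantumManyBody.PeriodicFeynmanKacCell
import HarnessLib

/-! # Crux `PeriodicIRBound` (stmt-AtomisticToContinuum-3972), line `linear-ph-floor-wagner`, stub 5b `stub_wagnerFeynman` — HeartKin
The kinetic Wagner–Feynman identity, part 1: orthonormality of the one-particle modes on the cell, kinetic Parseval `T[g] = ∑_q |2πq/L|² ‖a_q g‖²` for core functions, CCR bookkeeping, `‖a_q a_p†Φ‖²` mode by mode. -/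

/-!
# Stub 5b (`stub_wagnerFeynman`), §D-kin: the kinetic Wagner–Feynman identity through the modes

(K2), the kinetic Parseval `∫|∇g|² = ∑_q |q|² ‖a_q g‖²` for UNNORMALISED core functions (K3, by scaling the tree's
trial-state version), then the identity
`T[aΦ] + T[a†Φ] = ‖p‖²‖Φ‖² + T[Φ] + 2·(‖p‖² n_p(Φ) + ∑_q |q|² ‖a_p a_q Φ‖²)` (D-kin).
-/

noncomputable section

open scoped BigOperators ENNReal ComplexConjugate Topology
open Filter MeasureTheory

namespace Summit.AtomisticToContinuum.BoseEinsteinCondensation.Cruxes.PeriodicIRBound.LinearPhFloorWagner.WF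

open Literature.MathematicalPhysics.QuantumManyBody.BoseGas

variable {M m n : ℕ} {L : ℝ}

/-! ### K1: orthonormality of the smooth plane waves on the cell -/

/-- `(√(L³))⁻¹ · (√(L³))⁻¹ = (L³)⁻¹` in `ℂ` (`0 < L`). [folklore] -/
theorem sqrt_inv_mul_sqrt_inv (hL : 0 < L) :
    ((Real.sqrt (L ^ 3))⁻¹ : ℂ) * ((Real.sqrt (L ^ 3))⁻¹ : ℂ) = (((L ^ 3)⁻¹ : ℝ) : ℂ) := by
  have h3 : (0 : ℝ) ≤ L ^ 3 := by positivity
  rw [← Complex.ofReal_inv, ← Complex.ofReal_mul, ← mul_inv, Real.mul_self_sqrt h3]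

/-- **Orthonormality** `∫_cell conj(φ_q) φ_p = [q = p]` of the normalised smooth plane waves. [folklore] -/
theorem integral_cell_conj_planeWaveMode_mul (hL : 0 < L) (q p : Fin 3 → ℤ) :
    ∫ x in cell L, conj (planeWaveMode L q x) * planeWaveMode L p x = if q = p then 1 else 0 := by
  have hpt : ∀ x, conj (planeWaveMode L q x) * planeWaveMode L p x =
      (((L ^ 3)⁻¹ : ℝ) : ℂ) * (cellWave L (-q) x * cellWave L p x) := by
    intro x
    rw [planeWaveMode_eq, planeWaveMode_eq, map_mul, ← Complex.ofReal_inv, Complex.conj_ofReal,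
      Complex.ofReal_inv, conj_cellWave, ← sqrt_inv_mul_sqrt_inv hL]
    ring
  simp_rw [hpt]
  rw [integral_const_mul, integral_cell_cellWave_mul_cellWave hL]
  by_cases hqp : q = p
  · subst hqp
    simp only [neg_add_cancel, ↓reduceIte]
    have hL3 : (L : ℂ) ^ 3 ≠ 0 := pow_ne_zero _ (Complex.ofReal_ne_zero.2 hL.ne')
    rw [Complex.ofReal_inv]
    push_cast
    exact inv_mul_cancel₀ hL3
  · have : ¬(-q + p = 0) := fun h => hqp (neg_add_eq_zero.1 h)
    simp [this, hqp]

/-- `∫_cell |φ_p|² = 1` (as the complex integral `∫ conj(φ_p) φ_p`). [folklore] -/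
theorem integral_cell_conj_planeWaveMode_mul_self (hL : 0 < L) (p : Fin 3 → ℤ) :
    ∫ x in cell L, conj (planeWaveMode L p x) * planeWaveMode L p x = 1 := by
  rw [integral_cell_conj_planeWaveMode_mul hL, if_pos rfl]

/-! ### K2: `a(planeWave) = a(planeWaveMode)` -/

/-- The tree's indicator plane wave and the smooth plane wave give the same annihilation operator
(the contraction only sees the cell). [folklore] -/
theorem modeAn_planeWave_eq (L : ℝ) (k : Fin 3 → ℤ) (Ψ : Config (n + 1) → ℂ) :
    modeAn L (planeWave L k) Ψ = modeAn L (planeWaveMode L k) Ψ := by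
  funext Y
  simp only [modeAn_apply]
  congr 1
  refine setIntegral_congr_fun (measurableSet_cell L) fun x hx => ?_
  simp only [planeWave_apply_of_mem hx, planeWaveMode_eq]

/-! ### K3: the kinetic Parseval for unnormalised core functions -/

/-- `waveVector L q = latticeVec (2π/L) q`. [folklore] -/
theorem waveVector_eq_latticeVec (L : ℝ) (q : Fin 3 → ℤ) :
    waveVector L q = latticeVec (2 * Real.pi / L) q := by
  ext j
  simp only [waveVector_apply, latticeVec, PiLp.toLp_apply]
  ring

/-- A continuous function on the torus with `‖g‖²_cell = 0` vanishes on the open box. [folklore] -/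
theorem eq_zero_of_normSq_eq_zero_of_mem_box {g : Config M → ℂ} (hg : Continuous g) (h0 : normSq L g = 0)
    {X : Config M} (hX : ∀ i a, X i a ∈ Set.Ioo 0 L) : g X = 0 := by
  by_contra hne
  exact (lintegral_cellN_pos hg hX hne).ne' h0

/-- A continuous function on the torus with `‖g‖²_cell = 0` vanishes on the half-open cell (approach a
cell point along the diagonal from inside the open box). [folklore] -/
theorem eq_zero_of_normSq_eq_zero_of_mem_cellN {g : Config M → ℂ} (hg : Continuous g)
    (h0 : normSq L g = 0) {X : Config M} (hX : X ∈ cellN M L) : g X = 0 := by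
  -- the diagonal path `t ↦ X + t·𝟙`
  set D : Config M := fun _ => (EuclideanSpace.single (0 : Fin 3) (1 : ℝ) +
    EuclideanSpace.single 1 1 + EuclideanSpace.single 2 1) with hD
  have hDia : ∀ (i : Fin M) (a : Fin 3), D i a = 1 := by
    intro i a
    fin_cases a <;> simp [hD]
  have hpath : Continuous fun t : ℝ => g (X + t • D) := hg.comp (continuous_const.add (continuous_id.smul continuous_const))
  -- a margin below `L`
  obtain ⟨δ, hδ, hδlt⟩ : ∃ δ : ℝ, 0 < δ ∧ ∀ i a, X i a + δ < L := by
    classical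
    have hfin : ∀ i a, 0 < L - X i a := fun i a => sub_pos.2 (hX i a).2
    by_cases hM : M = 0
    · subst hM
      exact ⟨1, one_pos, fun i => Fin.elim0 i⟩
    · haveI : Nonempty (Fin M) := Fin.pos_iff_nonempty.1 (Nat.pos_of_ne_zero hM)
      set s : Finset ℝ := Finset.univ.image fun ia : Fin M × Fin 3 => L - X ia.1 ia.2 with hs
      have hsne : s.Nonempty := Finset.image_nonempty.2 Finset.univ_nonempty
      refine ⟨s.min' hsne / 2, half_pos (by
        obtain ⟨ia, -, hia⟩ := Finset.mem_image.1 (Finset.min'_mem s hsne)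
        rw [← hia]; exact hfin _ _), fun i a => ?_⟩
      have hle : s.min' hsne ≤ L - X i a := Finset.min'_le _ _ (Finset.mem_image.2 ⟨(i, a), Finset.mem_univ _, rfl⟩)
      have hpos : 0 < s.min' hsne := by
        obtain ⟨ia, -, hia⟩ := Finset.mem_image.1 (Finset.min'_mem s hsne)
        rw [← hia]; exact hfin _ _
      linarith
  -- for `0 < t < δ` the point is in the open box
  have hzero : ∀ t ∈ Set.Ioo (0 : ℝ) δ, g (X + t • D) = 0 := by
    intro t ht
    refine eq_zero_of_normSq_eq_zero_of_mem_box hg h0 fun i a => ?_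
    have : (X + t • D) i a = X i a + t := by
      simp [hDia]
    rw [this]
    exact ⟨by linarith [(hX i a).1, ht.1], by linarith [hδlt i a, ht.2]⟩
  -- pass to the limit `t → 0⁺`
  have hlim : Tendsto (fun t : ℝ => g (X + t • D)) (𝓝[>] 0) (𝓝 (g X)) := by
    have := hpath.tendsto 0
    simp only [zero_smul, add_zero] at this
    exact this.mono_left nhdsWithin_le_nhds
  have hev : ∀ᶠ t in 𝓝[>] (0 : ℝ), g (X + t • D) = 0 := by
    filter_upwards [Ioo_mem_nhdsGT hδ] with t ht using hzero t ht
  exact tendsto_nhds_unique hlim (tendsto_const_nhds.congr' (hev.mono fun t ht => ht.symm))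

/-- A periodic continuous function with `‖g‖²_cell = 0` vanishes identically. [folklore] -/
theorem eq_zero_of_normSq_eq_zero (hL : 0 < L) {g : Config M → ℂ} (hg : Continuous g) (hper : IsTorusPeriodic L g)
    (h0 : normSq L g = 0) : g = 0 := by
  funext X
  rw [← apply_cellProj_of_periodic hper X]
  exact eq_zero_of_normSq_eq_zero_of_mem_cellN hg h0 (cellProj_mem_cellN hL X)

/-- The occupation `‖a_q g‖²_{cell}` of the mode `q` in an unnormalised `(m+1)`-body function (`= cellOccupation`). -/
theorem normSq_modeAn_eq_cellOccupation (L : ℝ) (q : Fin 3 → ℤ) (g : Config (m + 1) → ℂ) :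
    normSq L (modeAn L (planeWaveMode L q) g) = cellOccupation (m + 1) L (planeWaveMode L q) g := by
  rw [cellOccupation_eq_lintegral_modeAn]
  rfl

/-- `normSq` of a continuous function on the cell is finite. [folklore] -/
theorem normSq_ne_top (L : ℝ) {g : Config M → ℂ} (hg : Continuous g) : normSq L g ≠ ⊤ :=
  (lintegral_cellN_sq_lt_top L hg).ne

/-- **Kinetic Parseval for core functions**: `∫_{cell}|∇g|² = ∑_q |2πq/L|² ‖a_q g‖²` for every `C¹` periodic
Bose-symmetric `(m+1)`-body `g` (the tree's trial-state identity `lintegral_kineticDensity_eq_tsum_modeAn`, extended by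
scaling; `g = 0` when `‖g‖ = 0`). [cite: LSSY2005, App. A (A.6), (A.10)] -/
theorem lintegral_kineticDensity_eq_tsum_normSq_modeAn (hL : 0 < L) {g : Config (m + 1) → ℂ} (hg : IsCore L g) :
    ∫⁻ X in cellN (m + 1) L, kineticDensity g X =
      ∑' q : Fin 3 → ℤ, ENNReal.ofReal (‖waveVector L q‖ ^ 2) * normSq L (modeAn L (planeWaveMode L q) g) := by
  by_cases h0 : normSq L g = 0
  · -- `g = 0`
    have hg0 : g = 0 := eq_zero_of_normSq_eq_zero hL hg.contDiff.continuous hg.periodic h0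
    subst hg0
    have h1 : ∀ X : Config (m + 1), kineticDensity (0 : Config (m + 1) → ℂ) X = 0 := fun X => by
      simp [kineticDensity]
    simp only [h1, lintegral_zero, modeAn_zero]
    simp [normSq]
  · -- normalise
    have htop : normSq L g ≠ ⊤ := normSq_ne_top L hg.contDiff.continuous
    set Ψ : PeriodicTrialState (m + 1) L := PeriodicTrialState.ofFun g hg.contDiff hg.periodic hg.symm h0 htop with hΨ
    set c : ℂ := ((Real.sqrt (normSq L g).toReal)⁻¹ : ℂ) with hc
    have hΨψ : Ψ.ψ = fun X => c * g X := funext fun X => PeriodicTrialState.ofFun_apply g _ _ _ h0 htop X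
    have hcpos : 0 < (normSq L g).toReal := ENNReal.toReal_pos h0 htop
    have hcsq : ((‖c‖₊ : ℝ≥0∞)) ^ 2 = (normSq L g)⁻¹ := by
      rw [coe_nnnorm_sq_eq_ofReal, hc, norm_inv, Complex.norm_real, Real.norm_of_nonneg (Real.sqrt_nonneg _),
        inv_pow, Real.sq_sqrt hcpos.le, ENNReal.ofReal_inv_of_pos hcpos, ENNReal.ofReal_toReal htop]
    have hcne0 : ((‖c‖₊ : ℝ≥0∞)) ^ 2 ≠ 0 := by rw [hcsq]; exact ENNReal.inv_ne_zero.2 htop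
    have hcnetop : ((‖c‖₊ : ℝ≥0∞)) ^ 2 ≠ ⊤ := by rw [hcsq]; exact ENNReal.inv_ne_top.2 h0
    -- the trial-state identity, both sides scaled by `‖c‖²`
    have key := lintegral_kineticDensity_eq_tsum_modeAn hL Ψ
    have hlhs : ∫⁻ X in cellN (m + 1) L, kineticDensity Ψ.ψ X =
        ((‖c‖₊ : ℝ≥0∞)) ^ 2 * ∫⁻ X in cellN (m + 1) L, kineticDensity g X := by
      rw [← lintegral_const_mul' _ _ hcnetop]
      refine lintegral_congr fun X => ?_
      rw [hΨψ, kineticDensity_const_mul' c (hg.contDiff.differentiable one_ne_zero)]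
    have hrhs : ∀ q, ∫⁻ Y in cellN m L, (‖modeAn L (planeWave L q) Ψ.ψ Y‖₊ : ℝ≥0∞) ^ 2 =
        ((‖c‖₊ : ℝ≥0∞)) ^ 2 * normSq L (modeAn L (planeWaveMode L q) g) := by
      intro q
      rw [modeAn_planeWave_eq, hΨψ, show (fun X => c * g X) = c • g from rfl, modeAn_smul]
      exact normSq_const_mul L c _
    rw [hlhs] at key
    simp only [hrhs] at key
    have key' : ((‖c‖₊ : ℝ≥0∞)) ^ 2 * ∫⁻ X in cellN (m + 1) L, kineticDensity g X =
        ((‖c‖₊ : ℝ≥0∞)) ^ 2 * ∑' q : Fin 3 → ℤ, ENNReal.ofReal (‖waveVector L q‖ ^ 2) *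
          normSq L (modeAn L (planeWaveMode L q) g) := by
      rw [key, ← ENNReal.tsum_mul_left]
      refine tsum_congr fun q => ?_
      ring
    exact (ENNReal.mul_right_inj hcne0 hcnetop).1 key'

/-! ### Assumed from the helper files (replaced on merge): regularity (B1, B2), `‖a†g‖² = ‖g‖² + ‖a g‖²` (B6) -/

/-! ### CCR, commutation and adjointness in the form used below -/

/-- The smooth plane waves are bounded measurable modes. [folklore] -/
theorem norm_planeWaveMode_le (L : ℝ) (k : Fin 3 → ℤ) (x : Space) :
    ‖planeWaveMode L k x‖ ≤ (Real.sqrt (L ^ 3))⁻¹ := (norm_planeWaveMode L k x).le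

/-- **CCR** `a_q(a_p† Φ) = [q = p] Φ + a_p†(a_q Φ)` for a continuous `(n+1)`-body `Φ`. [cite: LSSY2005, App. A (A.7)] -/
theorem modeAn_modeCr_planeWaveMode (hL : 0 < L) (q p : Fin 3 → ℤ) {Φ : Config (n + 1) → ℂ} (hΦ : Continuous Φ) :
    modeAn L (planeWaveMode L q) (modeCr (planeWaveMode L p) Φ) =
      fun Y => (if q = p then Φ Y else 0) + modeCr (planeWaveMode L p) (modeAn L (planeWaveMode L q) Φ) Y := by
  funext Y
  have hφψ : IntegrableOn (fun x => conj (planeWaveMode L q x) * planeWaveMode L p x) (cell L) volume :=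
    integrableOn_cell ((Complex.continuous_conj.comp (continuous_planeWaveMode L q)).mul (continuous_planeWaveMode L p))
  have hΨ : ∀ Z : Config n, IntegrableOn (fun x => conj (planeWaveMode L q x) * Φ (Matrix.vecCons x Z)) (cell L) volume :=
    fun Z => integrableOn_cell ((Complex.continuous_conj.comp (continuous_planeWaveMode L q)).mul
      (hΦ.comp (continuous_id.matrixVecCons continuous_const)))
  rw [modeAn_modeCr_apply hφψ hΨ Y, integral_cell_conj_planeWaveMode_mul hL]
  split_ifs <;> simp

/-- **`[a_q, a_p] = 0`** on continuous Bose-symmetric `(n+2)`-body functions. [cite: LSSY2005, App. A (A.7)] -/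
theorem modeAn_modeAn_planeWaveMode_comm (q p : Fin 3 → ℤ) {Φ : Config (n + 2) → ℂ} (hΦ : Continuous Φ)
    (hsymm : IsSymm Φ) :
    modeAn L (planeWaveMode L q) (modeAn L (planeWaveMode L p) Φ) =
      modeAn L (planeWaveMode L p) (modeAn L (planeWaveMode L q) Φ) :=
  modeAn_modeAn_comm (continuous_planeWaveMode L q).measurable (continuous_planeWaveMode L p).measurable
    (norm_planeWaveMode_le L q) (norm_planeWaveMode_le L p) hΦ hsymm

/-- **Adjointness** `⟨a_p Ψ, Φ⟩ = ⟨Ψ, a_p† Φ⟩` for continuous `Φ` and continuous symmetric `Ψ`. [cite: LSSY2005, App. A (A.13)–(A.14)] -/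
theorem integral_conj_modeAn_planeWaveMode_mul (p : Fin 3 → ℤ) {Φ : Config n → ℂ} (hΦ : Continuous Φ)
    {Ψ : Config (n + 1) → ℂ} (hΨ : Continuous Ψ) (hsymm : IsSymm Ψ) :
    ∫ Y in cellN n L, conj (modeAn L (planeWaveMode L p) Ψ Y) * Φ Y =
      ∫ X in cellN (n + 1) L, conj (Ψ X) * modeCr (planeWaveMode L p) Φ X :=
  integral_conj_modeAn_mul (continuous_planeWaveMode L p).measurable (norm_planeWaveMode_le L p) hΦ hΨ hsymm

/-! ### Real/complex bookkeeping for `normSq` and the inner product on the cell -/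

/-- `normSq` as a real Bochner integral for continuous functions. [folklore] -/
theorem normSq_eq_ofReal_integral (L : ℝ) {f : Config M → ℂ} (hf : Continuous f) :
    normSq L f = ENNReal.ofReal (∫ X in cellN M L, ‖f X‖ ^ 2) := by
  unfold normSq
  simp only [coe_nnnorm_sq_eq_ofReal]
  rw [← ofReal_integral_eq_lintegral_ofReal]
  · exact (integrableOn_cellN (hf.norm.pow 2) L)
  · exact Eventually.of_forall fun X => by positivity

/-- `∫ conj(f) f = ‖f‖²` (complex form). [folklore] -/
theorem integral_conj_mul_self_eq (L : ℝ) {f : Config M → ℂ} (hf : Continuous f) :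
    ∫ X in cellN M L, conj (f X) * f X = ((normSq L f).toReal : ℂ) := by
  rw [normSq_eq_ofReal_integral L hf, ENNReal.toReal_ofReal (integral_nonneg fun X => by positivity),
    ← integral_complex_ofReal]
  refine integral_congr_ae (Eventually.of_forall fun X => ?_)
  simp only [Complex.conj_mul', Complex.ofReal_pow]

/-- `⟨Φ, a_p†(a_p Φ)⟩ = ‖a_p Φ‖²` for a continuous symmetric `Φ`: the expectation of `n̂_p = a_p† a_p`. [folklore] -/
theorem integral_conj_mul_modeCr_modeAn (hL : 0 < L) (p : Fin 3 → ℤ) {Φ : Config (n + 1) → ℂ} (hΦ : IsCore L Φ) :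
    ∫ X in cellN (n + 1) L, conj (Φ X) * modeCr (planeWaveMode L p) (modeAn L (planeWaveMode L p) Φ) X =
      ((normSq L (modeAn L (planeWaveMode L p) Φ)).toReal : ℂ) := by
  have hc : Continuous (modeAn L (planeWaveMode L p) Φ) := (isCore_modeAn hL p hΦ).contDiff.continuous
  rw [← integral_conj_modeAn_planeWaveMode_mul p hc hΦ.contDiff.continuous hΦ.symm,
    integral_conj_mul_self_eq L hc]

/-- `‖f + g‖² = ‖f‖² + ‖g‖² + 2 Re⟨f, g⟩` in `ℝ≥0∞` when `Re⟨f,g⟩ ≥ 0` is given as the real part of `∫ conj(f) g`. [folklore] -/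
theorem normSq_add_of_re_nonneg (L : ℝ) {f g : Config M → ℂ} (hf : Continuous f) (hg : Continuous g) {r : ℝ}
    (hr : 0 ≤ r) (hfg : (∫ X in cellN M L, conj (f X) * g X).re = r) :
    normSq L (fun X => f X + g X) = normSq L f + normSq L g + 2 * ENNReal.ofReal r := by
  have hif : Integrable (fun X => ‖f X‖ ^ 2) (volume.restrict (cellN M L)) :=
    integrableOn_cellN (hf.norm.pow 2) L
  have hig : Integrable (fun X => ‖g X‖ ^ 2) (volume.restrict (cellN M L)) :=
    integrableOn_cellN (hg.norm.pow 2) L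
  have hifg : Integrable (fun X => conj (f X) * g X) (volume.restrict (cellN M L)) :=
    integrableOn_cellN ((Complex.continuous_conj.comp hf).mul hg) L
  have hire : Integrable (fun X => 2 * (conj (f X) * g X).re) (volume.restrict (cellN M L)) :=
    (Complex.reCLM.integrable_comp hifg).const_mul 2
  have hre : ∫ X in cellN M L, (conj (f X) * g X).re = r := by
    rw [← hfg]
    exact integral_re hifg
  rw [show (fun X => f X + g X) = f + g from rfl, normSq_eq_ofReal_integral L (hf.add hg),
    normSq_eq_ofReal_integral L hf, normSq_eq_ofReal_integral L hg]
  simp only [Pi.add_apply]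
  have hpt : ∀ X, ‖f X + g X‖ ^ 2 = ‖f X‖ ^ 2 + ‖g X‖ ^ 2 + 2 * (conj (f X) * g X).re := by
    intro X
    rw [← Complex.normSq_eq_norm_sq, ← Complex.normSq_eq_norm_sq, ← Complex.normSq_eq_norm_sq, Complex.normSq_add]
    have : (f X * conj (g X)).re = (conj (f X) * g X).re := by
      rw [← Complex.conj_re (f X * conj (g X)), map_mul, Complex.conj_conj, mul_comm]
    rw [this]
  have hifg2 : Integrable (fun X => ‖f X‖ ^ 2 + ‖g X‖ ^ 2) (volume.restrict (cellN M L)) := hif.add hig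
  simp_rw [hpt]
  rw [integral_add hifg2 hire, integral_add hif hig, integral_const_mul, hre,
    ENNReal.ofReal_add (by positivity) (by positivity),
    ENNReal.ofReal_add (integral_nonneg fun _ => by positivity) (integral_nonneg fun _ => by positivity),
    ENNReal.ofReal_mul (by norm_num), ENNReal.ofReal_ofNat]

/-! ### The occupations of `a_p† Φ`, mode by mode -/

/-- **Per-mode occupations of the particle state**: for a core `(n+2)`-body `Φ`,
`‖a_q a_p† Φ‖² = ‖a_q Φ‖² + ‖a_p a_q Φ‖² + [q = p](‖Φ‖² + 2‖a_p Φ‖²)`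
(CCR; for `q ≠ p` the state is `a_p†(a_qΦ)`; for `q = p` it is `Φ + a_p†(a_pΦ)` and `⟨Φ, a_p†a_pΦ⟩ = ‖a_pΦ‖²`). [folklore] -/
theorem normSq_modeAn_modeCr_planeWaveMode (hL : 0 < L) (q p : Fin 3 → ℤ) {Φ : Config (n + 2) → ℂ} (hΦ : IsCore L Φ) :
    normSq L (modeAn L (planeWaveMode L q) (modeCr (planeWaveMode L p) Φ)) =
      normSq L (modeAn L (planeWaveMode L q) Φ) +
        normSq L (modeAn L (planeWaveMode L p) (modeAn L (planeWaveMode L q) Φ)) +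
        (if q = p then normSq L Φ + 2 * normSq L (modeAn L (planeWaveMode L p) Φ) else 0) := by
  have hqΦ : IsCore L (modeAn L (planeWaveMode L q) Φ) := isCore_modeAn hL q hΦ
  -- `‖a_p†(a_qΦ)‖² = ‖a_qΦ‖² + ‖a_p a_qΦ‖²`
  have hB6 : normSq L (modeCr (planeWaveMode L p) (modeAn L (planeWaveMode L q) Φ)) =
      normSq L (modeAn L (planeWaveMode L q) Φ) + normSq L (modeAn L (planeWaveMode L p) (modeAn L (planeWaveMode L q) Φ)) := by
    rw [normSq_modeCr hL p hqΦ, ← normSq_modeAn_eq_cellOccupation]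
  rw [modeAn_modeCr_planeWaveMode hL q p hΦ.contDiff.continuous]
  by_cases hqp : q = p
  · subst hqp
    simp only [↓reduceIte]
    have hcont : Continuous (modeCr (planeWaveMode L q) (modeAn L (planeWaveMode L q) Φ)) :=
      (isCore_modeCr hL q hqΦ).contDiff.continuous
    have hre : (∫ X in cellN (n + 2) L, conj (Φ X) * modeCr (planeWaveMode L q) (modeAn L (planeWaveMode L q) Φ) X).re =
        (normSq L (modeAn L (planeWaveMode L q) Φ)).toReal := by
      rw [integral_conj_mul_modeCr_modeAn hL q hΦ, Complex.ofReal_re]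
    rw [normSq_add_of_re_nonneg L hΦ.contDiff.continuous hcont ENNReal.toReal_nonneg hre, hB6,
      ENNReal.ofReal_toReal (normSq_ne_top L hqΦ.contDiff.continuous)]
    ring
  · simp only [hqp, ↓reduceIte, zero_add, add_zero]
    exact hB6

end Summit.AtomisticToContinuum.BoseEinsteinCondensation.Cruxes.PeriodicIRBound.LinearPhFloorWagner.WF

end

namespace Summit.AtomisticToContinuum.BoseEinsteinCondensation.Cruxes.PeriodicIRBound.LinearPhFloorWagner

/-- The registered sub-goal `stub_wfHeartKin` of the crux ledger: this file's headline lemma `WF.lintegral_kineticDensity_eq_tsum_normSq_modeAn`. -/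
theorem stub_wfHeartKin : WF.Pkg.HeartKin :=
  @WF.lintegral_kineticDensity_eq_tsum_normSq_modeAn

end Summit.AtomisticToContinuum.BoseEinsteinCondensation.Cruxes.PeriodicIRBound.LinearPhFloorWagner
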